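import Literature.Probability.RandomPlanarGeometry.SAWStripTM
import HarnessLib

/-!
# Evaluation of the strip transfer matrix for span 6 (`native_decide`)

Topic `Literature/Probability/RandomPlanarGeometry`. The compiled evaluation of
`StripTM.dp 6 81 40 = 225595924835659017` (`/ 2⁶⁴ = 0.0122296`, the span-6 contribution to the
irreducible-bridge Kraft sum at fugacity `1/2.6`; 11 969 signatures, ≈ 8·10⁶ transitions,
≈ 3 minutes). Axiom: `Lean.ofReduceBool` (`native_decide`, `computational`).

## References

* I. Jensen, J. Phys. A 37 (2004) 11521–11529, §2.
-/

namespace Literature.Probability.RandomPlanarGeometry.SAW.StripTM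

/-- Span 6. [cite: Jensen2004SAWLowerBounds, §2] -/
theorem dp_six : dp 6 81 40 = 225595924835659017 := by native_decide

end Literature.Probability.RandomPlanarGeometry.SAW.StripTM
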